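import Mathlib
import Literature.MathematicalPhysics.QuantumFieldTheory.ConstructiveQFTWave0OddRPProofs
import Literature.MathematicalPhysics.QuantumFieldTheory.ConstructiveQFTWave0Proofs
import Literature.MathematicalPhysics.QuantumFieldTheory.LatticeGaugeProofs
import Literature.MathematicalPhysics.QuantumFieldTheory.LatticeGaugeStaticPotentialProofs
import Literature.MathematicalPhysics.QuantumFieldTheory.QCDTimeReflection
import Literature.MathematicalPhysics.QuantumFieldTheory.YangMillsOS
import Literature.MathematicalPhysics.QuantumLattice.LatticeGaugeDLR
import Literature.Probability.LatticeModels.SharpnessProofs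
import Summits.QuantumFields.YangMills.Theorems.FiniteSusceptibilityWeakCoupling.Negative.BetaZeroClause
import HarnessLib

/-!
# Mirror domination along the time axis (positive orientation)

Crux `stmt-QuantumFields-9442` (`…Theses.FradkinShenkerFlow.FiniteSusceptibilityWeakCoupling`),
line `sup-axis-reflection-transfer`, stub `stub_mirrorDominationAxis0` (STUB 2b of the skeleton; stated
with the QFT namespace opened in its hypothesis = the registered text, re-checked in full by `example`).

**Proved.** Centred reflection positivity with the discriminant Cauchy–Schwarz inequality on the odd
torus `(ℤ/(2S+1))⁴` in every plane (STUB 2a, the hypothesis; used only with `π = 1`, `v = p e₀`)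
implies, for every compact `G`, every lattice representation `r`, every `β ≥ 0` and all local
gauge-invariant `A, B`: with `(Pᵢ, Qᵢ) = (A, Aᴿ), (Aᴿ, A), (Bᴿ, B), (B, Bᴿ)`, every `x ∈ box 4 S`
with `x 0 = ‖x‖∞ = n ≥ 2R₀ + 2` (`R₀` the time radius of the supports) satisfies
`|Cov_S(A∘lift, B∘τ_x∘lift)| ≤ Σ_{j ≤ S, |j - n| ≤ 1} Σᵢ |Cov_S(Pᵢ∘lift, Qᵢ∘τ_{j e₀}∘lift)|`.

**Mechanism.** Reflect through the link hyperplane `t = p + ½`, `p = ⌊n/2⌋`, midway between `supp A`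
and `supp τ_x B`; Cauchy–Schwarz bounds `Cov(A, τ_x B)²` by the product of the diagonal terms, the
axis-`0` covariances of `(A, Aᴿ)` at lag `2p+1` and of `(Bᴿ, B)` at lag `2n-2p-1`, `Aᴿ := A ∘ Θ` the MIRROR
SPECIES (`reflSpecies`, on `QCDTimeReflection.cfgReflect`); keys: `torusLift (Θ₀ U) = τ_{e₀} (Θ (torusLift U))`
(`torusLift_timeReflect`), `configShift_torusLift`, `Θ ∘ τ_w = τ_{θw} ∘ Θ` (`cfgReflect_configShift`);
the transverse part of `x` drops out by translation invariance; a lag `S + 1` folds to `S`. [folklore]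
-/

noncomputable section

open MeasureTheory ProbabilityTheory Finset
open Literature.MathematicalPhysics.QuantumFieldTheory hiding Site ZdEdge
open Literature.MathematicalPhysics.QuantumLattice
open Literature.Probability.LatticeModels hiding configShift configShift_apply

namespace Summit.QuantumFields.YangMills.Theorems.FiniteSusceptibilityWeakCoupling

namespace MirrorDominationAxis0

variable {G : Type}

/-- The site reflection in coordinates: the time coordinate is negated, the others kept. [folklore] -/
theorem siteReflect_apply (x : Site 4) (k : Fin 4) :
    siteReflect x k = if k = 0 then -x 0 else x k := by
  by_cases hk : k = 0 <;> simp [siteReflect_apply_of_ne, hk]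

/-- The site reflection commutes with negation. [folklore] -/
theorem siteReflect_neg (x : Site 4) : siteReflect (-x) = -siteReflect x := by
  funext k; simp only [siteReflect_apply, Pi.neg_apply]; split_ifs <;> ring

/-- The site reflection is subtractive. [folklore] -/
theorem siteReflect_sub (x y : Site 4) : siteReflect (x - y) = siteReflect x - siteReflect y := by
  funext k; simp only [siteReflect_apply, Pi.sub_apply]; split_ifs <;> ring

/-- The site reflection negates a temporal vector. [folklore] -/
theorem siteReflect_single_zero (c : ℤ) :
    siteReflect (Pi.single 0 c : Site 4) = -Pi.single 0 c := by
  funext k; by_cases hk : k = 0 <;> simp [siteReflect_apply, hk]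

/-- `reflectEdge` is an involution. [folklore] -/
theorem reflectEdge_reflectEdge (e : ZdEdge 4) : reflectEdge (reflectEdge e) = e := by
  obtain ⟨x, i⟩ := e
  by_cases hi : i = 0
  · subst hi
    simp only [reflectEdge, ↓reduceIte, Prod.mk.injEq, and_true]
    rw [siteReflect_sub, siteReflect_siteReflect, siteReflect_single_zero]; abel
  · simp [reflectEdge, hi]

/-- The time coordinate of the reflected edge. [folklore] -/
theorem reflectEdge_fst_zero (e : ZdEdge 4) :
    (reflectEdge e).1 0 = if e.2 = 0 then -e.1 0 - 1 else -e.1 0 := by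
  unfold reflectEdge; split_ifs <;> simp

/-- `Torus.proj` commutes with negation. [folklore] -/
theorem proj_neg (L : ℕ) (x : Site 4) : Torus.proj L (-x) = -Torus.proj L x := by
  funext i; simp [Torus.proj_apply]

/-- `Torus.proj` is subtractive. [folklore] -/
theorem proj_sub (L : ℕ) (x y : Site 4) :
    Torus.proj L (x - y) = Torus.proj L x - Torus.proj L y := by
  funext i; simp [Torus.proj_apply]

/-- A full period projects to zero. [folklore] -/
theorem proj_single_self (L : ℕ) : Torus.proj L (Pi.single 0 (L : ℤ) : Site 4) = 0 := by
  funext i; by_cases hi : i = 0 <;> simp [Torus.proj_apply, hi]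

/-- The inverse of the identity axis permutation is the identity. [folklore] -/
theorem perm_one_symm : (1 : Equiv.Perm (Fin 4)).symm = 1 := rfl

/-- A torus edge whose `ℤ⁴` time coordinate lies in `[p+1, p+S]` is a positive link of the odd torus
`(ℤ/(2S+1))⁴` for the reflection through the link hyperplane `t = p + ½` (plane `(1, p e₀)`).
[folklore] -/
theorem torusEdge_mem_pos (S p : ℕ) (y : Site 4) (i : Fin 4) (h1 : (p : ℤ) + 1 ≤ y 0)
    (h2 : y 0 ≤ p + S) :
    torusEdge (2 * S + 1) (y, i) ∈ {e : Edge 4 (2 * S + 1) |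
      WilsonOddRP.IsOPosEdge (sitePerm (1 : Equiv.Perm (Fin 4)).symm
        (e.1 - Torus.proj (2 * S + 1) (Pi.single 0 (p : ℤ))), (1 : Equiv.Perm (Fin 4)).symm e.2) ∨
      WilsonOddRP.IsOSharedEdge (sitePerm (1 : Equiv.Perm (Fin 4)).symm
        (e.1 - Torus.proj (2 * S + 1) (Pi.single 0 (p : ℤ))), (1 : Equiv.Perm (Fin 4)).symm e.2)} := by
  rw [Set.mem_setOf_eq]; left
  have hL : (2 * S + 1) / 2 = S := by omega
  have hz : (sitePerm (1 : Equiv.Perm (Fin 4)).symm ((torusEdge (2 * S + 1) (y, i)).1 -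
      Torus.proj (2 * S + 1) (Pi.single 0 (p : ℤ)))) 0 = ((y 0 - p : ℤ) : ZMod (2 * S + 1)) := by
    simp [torusEdge, Torus.proj_apply, perm_one_symm]
  have hval : ((((y 0 - p : ℤ) : ZMod (2 * S + 1))).val : ℤ) = y 0 - p := by
    rw [ZMod.val_intCast]; exact Int.emod_eq_of_lt (by omega) (by push_cast; omega)
  unfold WilsonOddRP.IsOPosEdge; dsimp only; rw [hz, hL]; constructor <;> omega

/-- The elementary domination step: `c² ≤ D₁ D₂` and `0 ≤ Dᵢ ≤ M` give `|c| ≤ M`. [folklore] -/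
theorem abs_le_of_sq_le_mul {c D₁ D₂ M : ℝ} (h : c ^ 2 ≤ D₁ * D₂) (hD₁ : 0 ≤ D₁) (hD₂ : 0 ≤ D₂)
    (h₁ : D₁ ≤ M) (h₂ : D₂ ≤ M) : |c| ≤ M :=
  abs_le_of_sq_le_sq (h.trans ((mul_le_mul h₁ h₂ hD₂ (hD₁.trans h₁)).trans_eq (sq M).symm))
    (hD₁.trans h₁)

variable [MeasurableSpace G]

/-- Two translations of lattice configurations compose to the translation by the sum. [folklore] -/
theorem configShift_configShift {d : ℕ} (a b : Site d) (V : LGConfig d G) :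
    configShift a (configShift b V) = configShift (a + b) V := by
  funext e; simp only [configShift_apply, sub_sub]

/-- The trivial translation. [folklore] -/
@[simp] theorem configShift_zero {d : ℕ} (V : LGConfig d G) : configShift (0 : Site d) V = V := by
  funext e; simp

/-- **(L2)** The periodic lift intertwines the translations of `ℤ⁴` and of the torus. [folklore] -/
theorem configShift_torusLift (L : ℕ) (y : Site 4) (U : GaugeConfig 4 L G) :
    configShift y (torusLift L U) = torusLift L (torusConfigShift (Torus.proj L y) U) := by
  funext e
  simp only [configShift_apply, torusLift, Function.comp_apply, torusEdge, torusConfigShift_apply,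
    proj_sub]

/-- Periodicity of the lift: a translation by a period vector does nothing. [folklore] -/
theorem configShift_torusLift_of_proj_eq_zero (L : ℕ) {y : Site 4} (hy : Torus.proj L y = 0)
    (U : GaugeConfig 4 L G) : configShift y (torusLift L U) = torusLift L U := by
  rw [configShift_torusLift, hy]
  congr 1; funext e; simp

/-- The identity permutation of the axes fixes every torus configuration. [folklore] -/
theorem configPerm_one {L : ℕ} (W : GaugeConfig 4 L G) :
    configPerm (1 : Equiv.Perm (Fin 4)) W = W := by
  funext e; rfl

variable [Group G]

omit [MeasurableSpace G] in
/-- The configuration reflection `Θ` of `ℤ⁴` is an involution. [folklore] -/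
theorem cfgReflect_cfgReflect (V : LGConfig 4 G) : cfgReflect (cfgReflect V) = V := by
  funext e
  have h2 : (reflectEdge e).2 = e.2 := by unfold reflectEdge; split_ifs with h <;> simp [h]
  by_cases he : e.2 = 0
  · simp only [cfgReflect, he, ↓reduceIte, h2, inv_inv, reflectEdge_reflectEdge]
  · simp only [cfgReflect, he, ↓reduceIte, h2, reflectEdge_reflectEdge]

/-- **(L3)** The reflection intertwines the translations: `Θ ∘ τ_w = τ_{θ w} ∘ Θ`. [folklore] -/
theorem cfgReflect_configShift (w : Site 4) (V : LGConfig 4 G) :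
    cfgReflect (configShift w V) = configShift (siteReflect w) (cfgReflect V) := by
  funext e
  obtain ⟨x, i⟩ := e
  by_cases hi : i = 0
  · subst hi
    simp only [cfgReflect, ↓reduceIte, configShift_apply, reflectEdge]
    rw [siteReflect_sub, siteReflect_siteReflect]
    congr 3; abel
  · simp only [cfgReflect, hi, ↓reduceIte, configShift_apply, reflectEdge]
    rw [siteReflect_sub, siteReflect_siteReflect]

/-- `τ_z ∘ Θ = Θ ∘ τ_{θ z}`. [folklore] -/
theorem configShift_cfgReflect (z : Site 4) (V : LGConfig 4 G) :
    configShift z (cfgReflect V) = cfgReflect (configShift (siteReflect z) V) := by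
  rw [cfgReflect_configShift, siteReflect_siteReflect]

/-- Undoing a centred reflection: `τ_{-c e₀} ∘ Θ ∘ τ_{-c e₀} ∘ Θ = id`. [folklore] -/
theorem configShift_cfgReflect_configShift_single (c : ℤ) (V : LGConfig 4 G) :
    configShift (-(Pi.single 0 c)) (cfgReflect (configShift (-(Pi.single 0 c)) V)) =
      cfgReflect V := by
  rw [configShift_cfgReflect, configShift_configShift, siteReflect_neg, siteReflect_single_zero,
    neg_neg, add_neg_cancel, configShift_zero]

/-- **(L1)** The lift of the torus time reflection `θ t = 1 - t` (temporal links inverted) is the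
`ℤ⁴` reflection `t ↦ -t` followed by a unit time translation. [folklore] -/
theorem torusLift_timeReflect (L : ℕ) (U : GaugeConfig 4 L G) :
    torusLift L (GaugeConfig.timeReflect U) =
      configShift (Pi.single 0 1) (cfgReflect (torusLift L U)) := by
  funext ⟨y, i⟩
  have ht : Site.timeReflect (Literature.MathematicalPhysics.QuantumFieldTheory.Site.shift
      (Torus.proj L y) 0) = Torus.proj L (siteReflect (y - Pi.single 0 1) - Pi.single 0 1) := by
    funext k; by_cases hk : k = 0 <;> simp [Torus.proj_apply, siteReflect_apply, hk,
      WilsonRP.timeReflect_apply_of_ne, WilsonRP.shift_apply_of_ne]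
  have hs : Site.timeReflect (Torus.proj L y) = Torus.proj L (siteReflect (y - Pi.single 0 1)) := by
    funext k; by_cases hk : k = 0 <;> simp [Torus.proj_apply, siteReflect_apply, hk,
      WilsonRP.timeReflect_apply_of_ne]
  by_cases hi : i = 0
  · subst hi
    simp only [torusLift, Function.comp_apply, torusEdge, GaugeConfig.timeReflect, ↓reduceIte,
      configShift_apply, cfgReflect, reflectEdge, ht]
  · simp only [torusLift, Function.comp_apply, torusEdge, GaugeConfig.timeReflect, hi, ↓reduceIte,
      configShift_apply, cfgReflect, reflectEdge, hs]

/-- **The lifted mirror.** The reflection of the odd torus `(ℤ/(2S+1))⁴` through the link hyperplane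
`t = p + ½` (the transported reflection of the RP statement with `π = 1`, `v = p e₀`), lifted to
`ℤ⁴`, is the `ℤ⁴` reflection `Θ` precomposed with the time translation by `-(2p+1) e₀`. [folklore] -/
theorem torusLift_theta (S p : ℕ) (U : GaugeConfig 4 (2 * S + 1) G) :
    torusLift (2 * S + 1) (torusConfigShift (Torus.proj (2 * S + 1) (Pi.single 0 (p : ℤ)))
      (configPerm 1 (GaugeConfig.timeReflect (configPerm (1 : Equiv.Perm (Fin 4)).symm
        (torusConfigShift (-(Torus.proj (2 * S + 1) (Pi.single 0 (p : ℤ)))) U))))) =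
    cfgReflect (configShift (-(Pi.single 0 ((2 * p + 1 : ℕ) : ℤ))) (torusLift (2 * S + 1) U)) := by
  have hv : siteReflect ((Pi.single 0 (p : ℤ) : Site 4) + Pi.single 0 1 +
      siteReflect (-(Pi.single 0 (p : ℤ)))) = -(Pi.single 0 ((2 * p + 1 : ℕ) : ℤ)) := by
    funext k; by_cases hk : k = 0 <;> simp [siteReflect_apply, hk]
    ring
  rw [perm_one_symm, configPerm_one, configPerm_one, ← configShift_torusLift,
    torusLift_timeReflect, ← proj_neg, ← configShift_torusLift, cfgReflect_configShift,
    configShift_configShift, configShift_configShift, configShift_cfgReflect, hv]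

variable [TopologicalSpace G] [IsTopologicalGroup G] [BorelSpace G]

/-- **(L4) The mirror species `Aᴿ := A ∘ Θ`** of a local gauge-invariant observable `A` of `ℤ⁴`
(`Θ = cfgReflect`: `t ↦ -t`, temporal links inverted): a cylinder function of the reflected support,
gauge invariant by `Θ(Uᵍ) = (ΘU)^{g∘θ}` (`cfgReflect_gaugeTransformZd`), bounded by the same constant,
measurable by `measurable_cfgReflect`. [folklore] -/
def reflSpecies (A : YMSpecies G) : YMSpecies G where
  F := fun V => A.F (cfgReflect V)
  supp := A.supp.image reflectEdge
  isCylinder := by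
    intro U V h
    apply A.isCylinder
    intro e he
    have h' : U (reflectEdge e) = V (reflectEdge e) :=
      h (reflectEdge e) (Finset.mem_coe.2 (Finset.mem_image_of_mem _ (Finset.mem_coe.1 he)))
    show cfgReflect U e = cfgReflect V e
    simp only [cfgReflect, h']
  gaugeInvariant := fun g U => by
    show A.F (cfgReflect (gaugeTransformZd g U)) = A.F (cfgReflect U)
    rw [cfgReflect_gaugeTransformZd]; exact A.gaugeInvariant _ _
  bounded := let ⟨C, hC⟩ := A.bounded; ⟨C, fun U => hC _⟩
  measurable := A.measurable.comp measurable_cfgReflect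

/-- `Aᴿ ∘ τ_{-c e₀} ∘ Θ ∘ τ_{-c e₀} = A`: identification of the reflected diagonal observable.
[folklore] -/
theorem reflSpecies_F_shift_cfgReflect_shift (A : YMSpecies G) (c : ℤ) (V : LGConfig 4 G) :
    (reflSpecies A).F (configShift (-(Pi.single 0 c))
      (cfgReflect (configShift (-(Pi.single 0 c)) V))) = A.F V := by
  show A.F (cfgReflect _) = _
  rw [configShift_cfgReflect_configShift_single, cfgReflect_cfgReflect]

/-- `B ∘ τ_{-x} ∘ Θ ∘ τ_{-u} = Bᴿ ∘ τ_{-(θx + u)}`: identification of the reflected translate.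
[folklore] -/
theorem F_shift_cfgReflect_shift (B : YMSpecies G) (x u : Site 4) (V : LGConfig 4 G) :
    B.F (configShift (-x) (cfgReflect (configShift (-u) V))) =
      (reflSpecies B).F (configShift (-(siteReflect x + u)) V) := by
  show _ = B.F (cfgReflect _)
  rw [configShift_cfgReflect, configShift_configShift, siteReflect_neg, neg_add]

variable [CompactSpace G] {N : ℕ} (ρ : G →* Matrix (Fin N) (Fin N) ℂ) (β : ℝ)

/-- **Translation invariance** of the covariances of lifted observables (the torus Wilson state is
invariant under `torusConfigShift`, which the lift intertwines with `configShift`). [folklore] -/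
theorem cov_translate {L : ℕ} [NeZero L] (t : Site 4) (f g : LGConfig 4 G → ℝ) :
    cov[fun U => f (configShift t (torusLift L U)), fun U => g (configShift t (torusLift L U));
        wilsonMeasure (d := 4) (L := L) ρ β] =
      cov[fun U => f (torusLift L U), fun U => g (torusLift L U);
        wilsonMeasure (d := 4) (L := L) ρ β] := by
  have h := covariance_map_equiv (μ := wilsonMeasure (d := 4) (L := L) ρ β)
    (fun U => f (torusLift L U)) (fun U => g (torusLift L U)) (torusConfigShift (Torus.proj L t))
  rw [wilsonMeasure_map_torusConfigShift] at h; rw [h]; simp only [configShift_torusLift]; rfl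

/-- Translating both observables by `a`: `Cov(f ∘ τ_{-a}, g ∘ τ_b) = Cov(f, g ∘ τ_{b+a})`.
[folklore] -/
theorem cov_translate_left {L : ℕ} [NeZero L] {a b c : Site 4} (f g : LGConfig 4 G → ℝ)
    (h : b + a = c) :
    cov[fun U => f (configShift (-a) (torusLift L U)), fun U => g (configShift b (torusLift L U));
        wilsonMeasure (d := 4) (L := L) ρ β] =
      cov[fun U => f (torusLift L U), fun U => g (configShift c (torusLift L U));
        wilsonMeasure (d := 4) (L := L) ρ β] := by
  rw [← cov_translate ρ β a (fun V => f (configShift (-a) V)) (fun V => g (configShift b V))]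
  simp only [configShift_configShift, neg_add_cancel, configShift_zero, h]

/-- **Periodic fold of a lag.** On the torus of side `L` the axis covariance of `(P, Q)` at lag `j ≤ L`
equals that of `(Q, P)` at lag `L - j` (periodicity, translation invariance, symmetry). [folklore] -/
theorem cov_fold {L : ℕ} [NeZero L] (P Q : LGConfig 4 G → ℝ) {j : ℕ} (hj : j ≤ L) :
    cov[fun U => P (torusLift L U),
        fun U => Q (configShift (-(Pi.single 0 (j : ℤ))) (torusLift L U));
        wilsonMeasure (d := 4) (L := L) ρ β] =
      cov[fun U => Q (torusLift L U),
        fun U => P (configShift (-(Pi.single 0 ((L - j : ℕ) : ℤ))) (torusLift L U));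
        wilsonMeasure (d := 4) (L := L) ρ β] := by
  have hper : -(Pi.single 0 (j : ℤ) : Site 4) + -Pi.single 0 ((L - j : ℕ) : ℤ) =
      -Pi.single 0 (L : ℤ) := by
    funext k; by_cases hk : k = 0 <;> simp [hk]
    omega
  have h0 : Torus.proj L (-(Pi.single 0 (L : ℤ) : Site 4)) = 0 := by
    rw [proj_neg, proj_single_self, neg_zero]
  rw [covariance_comm (fun U => Q (torusLift L U)),
    ← cov_translate ρ β (-(Pi.single 0 ((L - j : ℕ) : ℤ))) P
      (fun V => Q (configShift (-(Pi.single 0 (j : ℤ))) V))]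
  simp only [configShift_configShift, hper, configShift_torusLift_of_proj_eq_zero L h0]

end MirrorDominationAxis0

open MirrorDominationAxis0 in
/-- **STUB 2b · mirror domination along the time axis, positive orientation** (crux
`stmt-QuantumFields-9442`, line `sup-axis-reflection-transfer`): centred RP + Cauchy–Schwarz in every
plane of the odd torus (the hypothesis, used with `π = 1`, `v = p e₀`, `p = ⌊n/2⌋`) implies, for
`x ∈ box 4 S` with `x 0 = ‖x‖∞ = n ≥ n₀ = 2R₀ + 2` (`R₀` the time radius of `supp A ∪ supp B`),
`|Cov_S(A∘lift, B∘τ_x∘lift)| ≤ Σ_{j ≤ S, |j-n| ≤ 1} Σ_{i<4} |Cov_S(Pᵢ∘lift, Qᵢ∘τ_{j e₀}∘lift)|`,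
`P = (A, Aᴿ, Bᴿ, B)`, `Q = (Aᴿ, A, B, Bᴿ)` (`k = 4`, `c = 1`, `w = 1`). With the positive-half
observables `F := Aᴿ∘τ_{-(2p+1)e₀}∘lift`, `G' := B∘τ_{-x}∘lift` (`torusEdge_mem_pos`) one has
`F∘Θ_p = A∘lift` (`torusLift_theta`), so `Cov(A∘lift, G')² ≤ D₁ D₂` with
`D₁ = Cov_S(A, τ_{(2p+1)e₀} Aᴿ) ≥ 0`, `D₂ = Cov(G'∘Θ_p, G') = Cov_S(Bᴿ, τ_{(2n-2p-1)e₀} B) ≥ 0`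
(`cov_translate_left`); a lag `2p + 1 = S + 1` is folded to `S` (`cov_fold`); `Dᵢ ≤ Σ`. [folklore] -/
theorem stub_mirrorDominationAxis0 : (∀ (G : Type) [Group G] [TopologicalSpace G] [IsTopologicalGroup G] [CompactSpace G] [MeasurableSpace G] [BorelSpace G] (N : ℕ) (ρ : G →* Matrix (Fin N) (Fin N) ℂ), Continuous ρ → ∀ (β : ℝ), 0 ≤ β → ∀ (S : ℕ), 1 ≤ S → ∀ (π : Equiv.Perm (Fin 4)) (v : Literature.MathematicalPhysics.QuantumFieldTheory.Site 4 (2 * S + 1)) (F G' : GaugeConfig 4 (2 * S + 1) G → ℝ), Measurable F → Measurable G' → (∃ C : ℝ, ∀ U, |F U| ≤ C) → (∃ C : ℝ, ∀ U, |G' U| ≤ C) → DependsOn F {e : Edge 4 (2 * S + 1) | WilsonOddRP.IsOPosEdge (sitePerm π.symm (e.1 - v), π.symm e.2) ∨ WilsonOddRP.IsOSharedEdge (sitePerm π.symm (e.1 - v), π.symm e.2)} → DependsOn G' {e : Edge 4 (2 * S + 1) | WilsonOddRP.IsOPosEdge (sitePerm π.symm (e.1 - v), π.symm e.2) ∨ WilsonOddRP.IsOSharedEdge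 (sitePerm π.symm (e.1 - v), π.symm e.2)} → 0 ≤ ProbabilityTheory.covariance (fun U => F (torusConfigShift v (configPerm π (GaugeConfig.timeReflect (configPerm π.symm (torusConfigShift (-v) U)))))) F (wilsonMeasure (d := 4) (L := 2 * S + 1) ρ β) ∧ 0 ≤ ProbabilityTheory.covariance (fun U => G' (torusConfigShift v (configPerm π (GaugeConfig.timeReflect (configPerm π.symm (torusConfigShift (-v) U)))))) G' (wilsonMeasure (d := 4) (L := 2 * S + 1) ρ β) ∧ (ProbabilityTheory.covariance (fun U => F (torusConfigShift v (configPerm π (GaugeConfig.timeReflect (configPerm π.symm (torusConfigShift (-v) U)))))) G' (wilsonMeasure (d := 4) (L := 2 * S + 1) ρ β)) ^ 2 ≤ ProbabilityTheory.covariance (fun U => F (torusConfigShift v (configPerm π (GaugeConfig.timeReflect (configPerm π.symm (torusConfigShift (-v) U)))))) F (wilsonMeasure (d := 4) (L := 2 * S + 1) ρ β) * ProbabilityTheory.covariance (fun U => G' (torusConfigShift v (configPerm π (GaugeConfig.timeReflect (configPerm π.symm (torusConfigShift (-v) U)))))) G' (wilsonMeasure (d := 4) (L := 2 * S + 1) ρ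 β)) → ∀ (G : Type) [Group G] [TopologicalSpace G] [IsTopologicalGroup G] [CompactSpace G] [MeasurableSpace G] [BorelSpace G] (r : Literature.MathematicalPhysics.QuantumFieldTheory.LatticeRep G) (β : ℝ), 0 ≤ β → ∀ A B : Literature.MathematicalPhysics.QuantumFieldTheory.YMSpecies G, ∃ (k : ℕ) (P Q : Fin k → Literature.MathematicalPhysics.QuantumFieldTheory.YMSpecies G) (c : ℝ) (w n₀ : ℕ), 0 ≤ c ∧ ∀ S : ℕ, ∀ x ∈ Literature.Probability.LatticeModels.box 4 S, n₀ ≤ Literature.Probability.LatticeModels.Site.supNorm x → x 0 = (Literature.Probability.LatticeModels.Site.supNorm x : ℤ) → |ProbabilityTheory.covariance (fun U => A.F (Literature.MathematicalPhysics.QuantumLattice.torusLift (2 * S + 1) U)) (fun U => B.F (Literature.MathematicalPhysics.QuantumLattice.configShift (-x) (Literature.MathematicalPhysics.QuantumLattice.torusLift (2 * S + 1) U))) (Literature.MathematicalPhysics.QuantumFieldTheory.wilsonMeasure (d := 4) (L := 2 * S + 1) r.ρ β)| ≤ c * ∑ j ∈ (Finset.range (S + 1)).filter (fun j => Literature.Probability.LatticeModels.Site.supNorm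 x ≤ j + w ∧ j ≤ Literature.Probability.LatticeModels.Site.supNorm x + w), ∑ i : Fin k, |ProbabilityTheory.covariance (fun U => (P i).F (Literature.MathematicalPhysics.QuantumLattice.torusLift (2 * S + 1) U)) (fun U => (Q i).F (Literature.MathematicalPhysics.QuantumLattice.configShift (-(Pi.single 0 (j : ℤ))) (Literature.MathematicalPhysics.QuantumLattice.torusLift (2 * S + 1) U))) (Literature.MathematicalPhysics.QuantumFieldTheory.wilsonMeasure (d := 4) (L := 2 * S + 1) r.ρ β)| := by
  intro hCS G _ _ _ _ _ _ r β hβ A B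
  -- the time radius `R₀` of the two supports; `k = 4`, `c = w = 1`, `n₀ = 2R₀ + 2`
  obtain ⟨R₀, hRA, hRB⟩ : ∃ R₀ : ℕ, (∀ e ∈ A.supp, (e.1 0).natAbs ≤ R₀) ∧
      ∀ e ∈ B.supp, (e.1 0).natAbs ≤ R₀ := ⟨(A.supp ∪ B.supp).sup fun e => (e.1 0).natAbs,
    fun e he => Finset.le_sup (f := fun e : ZdEdge 4 => (e.1 0).natAbs) (mem_union_left _ he),
    fun e he => Finset.le_sup (f := fun e : ZdEdge 4 => (e.1 0).natAbs) (mem_union_right _ he)⟩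
  refine ⟨4, ![A, reflSpecies A, reflSpecies B, B], ![reflSpecies A, A, B, reflSpecies B], 1, 1,
    2 * R₀ + 2, zero_le_one, ?_⟩
  intro S x hx hn hx0
  have hnS : Site.supNorm x ≤ S := mem_box_iff_supNorm_le.1 hx
  obtain ⟨p, hp⟩ : ∃ p : ℕ, p = Site.supNorm x / 2 := ⟨_, rfl⟩
  haveI : IsProbabilityMeasure (wilsonMeasure (d := 4) (L := 2 * S + 1) r.ρ β) :=
    isProbabilityMeasure_wilsonMeasure _ r.continuous β
  -- RP + Cauchy–Schwarz in the plane `(1, p e₀)` for `F = Aᴿ∘τ_{-(2p+1)e₀}∘lift`, `G' = B∘τ_{-x}∘lift`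
  obtain ⟨hD₁, hD₂, hcs⟩ := hCS G r.N r.ρ r.continuous β hβ S (by omega) 1
    (Torus.proj (2 * S + 1) (Pi.single 0 (p : ℤ)))
    (fun U => (reflSpecies A).F
      (configShift (-(Pi.single 0 ((2 * p + 1 : ℕ) : ℤ))) (torusLift (2 * S + 1) U)))
    (fun U => B.F (configShift (-x) (torusLift (2 * S + 1) U)))
    ((reflSpecies A).measurable.comp ((configShift _).measurable.comp (measurable_torusLift _)))
    (B.measurable.comp ((configShift _).measurable.comp (measurable_torusLift _)))
    (by obtain ⟨C, hC⟩ := (reflSpecies A).bounded; exact ⟨C, fun U => hC _⟩)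
    (by obtain ⟨C, hC⟩ := B.bounded; exact ⟨C, fun U => hC _⟩)
    (by
      refine (Negative.dependsOn_comp_configShift_torusLift (2 * S + 1) (reflSpecies A) _).mono ?_
      intro e he
      obtain ⟨e', he', rfl⟩ := Finset.mem_image.1 (Finset.mem_coe.1 he)
      obtain ⟨e'', he'', rfl⟩ := Finset.mem_image.1 he'
      have ht := hRA e'' he''
      have h0 : ((reflectEdge e'').1 + (Pi.single 0 ((2 * p + 1 : ℕ) : ℤ) : Site 4)) 0 =
          (if e''.2 = 0 then -e''.1 0 - 1 else -e''.1 0) + (2 * p + 1 : ℕ) := by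
        rw [Pi.add_apply, reflectEdge_fst_zero, Pi.single_eq_same]
      refine torusEdge_mem_pos S p _ _ ?_ ?_ <;> rw [h0] <;> split_ifs <;> omega)
    (by
      refine (Negative.dependsOn_comp_configShift_torusLift (2 * S + 1) B x).mono ?_
      intro e he
      obtain ⟨e', he', rfl⟩ := Finset.mem_image.1 (Finset.mem_coe.1 he)
      have ht := hRB e' he'
      have h0 : (e'.1 + x) 0 = e'.1 0 + Site.supNorm x := by rw [Pi.add_apply, hx0]
      refine torusEdge_mem_pos S p _ _ ?_ ?_ <;> rw [h0] <;> omega)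
  -- `F∘Θ = A∘lift`, `G'∘Θ = Bᴿ∘τ_{-(θx+(2p+1)e₀)}∘lift`, and the transverse part of `x` drops out
  simp only [torusLift_theta, reflSpecies_F_shift_cfgReflect_shift] at hD₁ hD₂ hcs
  simp only [F_shift_cfgReflect_shift] at hD₂ hcs
  have hvec : -x + (siteReflect x + Pi.single 0 ((2 * p + 1 : ℕ) : ℤ)) =
      -(Pi.single 0 ((2 * Site.supNorm x - 2 * p - 1 : ℕ) : ℤ)) := by
    funext k; by_cases hk : k = 0 <;> simp [siteReflect_apply, hk, hx0]
    omega
  rw [cov_translate_left r.ρ β (reflSpecies B).F B.F hvec] at hD₂ hcs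
  rw [one_mul]  -- bookkeeping of the window `|j - n| ≤ 1`
  set W := (Finset.range (S + 1)).filter
    (fun j => Site.supNorm x ≤ j + 1 ∧ j ≤ Site.supNorm x + 1) with hW
  set T : Fin 4 → ℕ → ℝ := fun i j =>
    cov[fun U => ((![A, reflSpecies A, reflSpecies B, B] : Fin 4 → YMSpecies G) i).F
        (torusLift (2 * S + 1) U),
      fun U => ((![reflSpecies A, A, B, reflSpecies B] : Fin 4 → YMSpecies G) i).F
        (configShift (-(Pi.single 0 (j : ℤ))) (torusLift (2 * S + 1) U));
      wilsonMeasure (d := 4) (L := 2 * S + 1) r.ρ β] with hT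
  show _ ≤ ∑ j ∈ W, ∑ i : Fin 4, |T i j|
  have hle : ∀ (i : Fin 4) (j : ℕ), j ≤ S → Site.supNorm x ≤ j + 1 → j ≤ Site.supNorm x + 1 →
      T i j ≤ ∑ j ∈ W, ∑ i : Fin 4, |T i j| :=
    fun i j h1 h2 h3 => (le_abs_self _).trans
      ((Finset.single_le_sum (f := fun i => |T i j|) (fun i _ => abs_nonneg _)
        (Finset.mem_univ i)).trans
        (Finset.single_le_sum (f := fun j => ∑ i : Fin 4, |T i j|)
          (fun j _ => Finset.sum_nonneg fun i _ => abs_nonneg _)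
          (Finset.mem_filter.2 ⟨Finset.mem_range.2 (by omega), h2, h3⟩)))
  have h2 : T 2 (2 * Site.supNorm x - 2 * p - 1) ≤ _ := hle 2 _ (by omega) (by omega) (by omega)
  by_cases hfold : 2 * p + 1 ≤ S
  · exact abs_le_of_sq_le_mul hcs hD₁ hD₂ (hle 0 _ hfold (by omega) (by omega)) h2
  · rw [cov_fold r.ρ β A.F (reflSpecies A).F (show 2 * p + 1 ≤ 2 * S + 1 by omega)] at hD₁ hcs
    exact abs_le_of_sq_le_mul hcs hD₁ hD₂ (hle 1 _ (by omega) (by omega) (by omega)) h2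

/-- Consistency check: `stub_mirrorDominationAxis0` IS the skeleton's STUB 2b with every tree name written
in full (`work/stubs/sig_stub_mirrorDominationAxis0.txt`); above, its hypothesis is STUB 2a's registered text
(`Literature.MathematicalPhysics.QuantumFieldTheory` opened: registered signatures are capped). [folklore] -/
example : (∀ (G : Type) [Group G] [TopologicalSpace G] [IsTopologicalGroup G] [CompactSpace G] [MeasurableSpace G] [BorelSpace G] (N : ℕ) (ρ : G →* Matrix (Fin N) (Fin N) ℂ), Continuous ρ → ∀ (β : ℝ), 0 ≤ β → ∀ (S : ℕ), 1 ≤ S → ∀ (π : Equiv.Perm (Fin 4)) (v : Literature.MathematicalPhysics.QuantumFieldTheory.Site 4 (2 * S + 1)) (F G' : Literature.MathematicalPhysics.QuantumFieldTheory.GaugeConfig 4 (2 * S + 1) G → ℝ), Measurable F → Measurable G' → (∃ C : ℝ, ∀ U, |F U| ≤ C) → (∃ C : ℝ, ∀ U, |G' U| ≤ C) → DependsOn F {e : Literature.MathematicalPhysics.QuantumFieldTheory.Edge 4 (2 * S + 1) | Literature.MathematicalPhysics.QuantumFieldTheory.WilsonOddRP.IsOPosEdge (Literature.MathematicalPhysics.QuantumFieldTheory.sitePerm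 π.symm (e.1 - v), π.symm e.2) ∨ Literature.MathematicalPhysics.QuantumFieldTheory.WilsonOddRP.IsOSharedEdge (Literature.MathematicalPhysics.QuantumFieldTheory.sitePerm π.symm (e.1 - v), π.symm e.2)} → DependsOn G' {e : Literature.MathematicalPhysics.QuantumFieldTheory.Edge 4 (2 * S + 1) | Literature.MathematicalPhysics.QuantumFieldTheory.WilsonOddRP.IsOPosEdge (Literature.MathematicalPhysics.QuantumFieldTheory.sitePerm π.symm (e.1 - v), π.symm e.2) ∨ Literature.MathematicalPhysics.QuantumFieldTheory.WilsonOddRP.IsOSharedEdge (Literature.MathematicalPhysics.QuantumFieldTheory.sitePerm π.symm (e.1 - v), π.symm e.2)} → 0 ≤ ProbabilityTheory.covariance (fun U => F (Literature.MathematicalPhysics.QuantumFieldTheory.torusConfigShift v (Literature.MathematicalPhysics.QuantumFieldTheory.configPerm π (Literature.MathematicalPhysics.QuantumFieldTheory.GaugeConfig.timeReflect (Literature.MathematicalPhysics.QuantumFieldTheory.configPerm π.symm (Literature.MathematicalPhysics.QuantumFieldTheory.torusConfigShift (-v) U)))))) F (Literature.MathematicalPhysics.QuantumFieldTheory.wilsonMeasure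 (d := 4) (L := 2 * S + 1) ρ β) ∧ 0 ≤ ProbabilityTheory.covariance (fun U => G' (Literature.MathematicalPhysics.QuantumFieldTheory.torusConfigShift v (Literature.MathematicalPhysics.QuantumFieldTheory.configPerm π (Literature.MathematicalPhysics.QuantumFieldTheory.GaugeConfig.timeReflect (Literature.MathematicalPhysics.QuantumFieldTheory.configPerm π.symm (Literature.MathematicalPhysics.QuantumFieldTheory.torusConfigShift (-v) U)))))) G' (Literature.MathematicalPhysics.QuantumFieldTheory.wilsonMeasure (d := 4) (L := 2 * S + 1) ρ β) ∧ (ProbabilityTheory.covariance (fun U => F (Literature.MathematicalPhysics.QuantumFieldTheory.torusConfigShift v (Literature.MathematicalPhysics.QuantumFieldTheory.configPerm π (Literature.MathematicalPhysics.QuantumFieldTheory.GaugeConfig.timeReflect (Literature.MathematicalPhysics.QuantumFieldTheory.configPerm π.symm (Literature.MathematicalPhysics.QuantumFieldTheory.torusConfigShift (-v) U)))))) G' (Literature.MathematicalPhysics.QuantumFieldTheory.wilsonMeasure (d := 4) (L := 2 * S + 1) ρ β)) ^ 2 ≤ ProbabilityTheory.covariance (fun U => F (Literature.MathematicalPhysics.QuantumFieldTheory.torusConfigShift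 v (Literature.MathematicalPhysics.QuantumFieldTheory.configPerm π (Literature.MathematicalPhysics.QuantumFieldTheory.GaugeConfig.timeReflect (Literature.MathematicalPhysics.QuantumFieldTheory.configPerm π.symm (Literature.MathematicalPhysics.QuantumFieldTheory.torusConfigShift (-v) U)))))) F (Literature.MathematicalPhysics.QuantumFieldTheory.wilsonMeasure (d := 4) (L := 2 * S + 1) ρ β) * ProbabilityTheory.covariance (fun U => G' (Literature.MathematicalPhysics.QuantumFieldTheory.torusConfigShift v (Literature.MathematicalPhysics.QuantumFieldTheory.configPerm π (Literature.MathematicalPhysics.QuantumFieldTheory.GaugeConfig.timeReflect (Literature.MathematicalPhysics.QuantumFieldTheory.configPerm π.symm (Literature.MathematicalPhysics.QuantumFieldTheory.torusConfigShift (-v) U)))))) G' (Literature.MathematicalPhysics.QuantumFieldTheory.wilsonMeasure (d := 4) (L := 2 * S + 1) ρ β)) → ∀ (G : Type) [Group G] [TopologicalSpace G] [IsTopologicalGroup G] [CompactSpace G] [MeasurableSpace G] [BorelSpace G] (r : Literature.MathematicalPhysics.QuantumFieldTheory.LatticeRep G) (β : ℝ), 0 ≤ β → ∀ A B : Literature.MathematicalPhysics.QuantumFieldTheory.YMSpecies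 G, ∃ (k : ℕ) (P Q : Fin k → Literature.MathematicalPhysics.QuantumFieldTheory.YMSpecies G) (c : ℝ) (w n₀ : ℕ), 0 ≤ c ∧ ∀ S : ℕ, ∀ x ∈ Literature.Probability.LatticeModels.box 4 S, n₀ ≤ Literature.Probability.LatticeModels.Site.supNorm x → x 0 = (Literature.Probability.LatticeModels.Site.supNorm x : ℤ) → |ProbabilityTheory.covariance (fun U => A.F (Literature.MathematicalPhysics.QuantumLattice.torusLift (2 * S + 1) U)) (fun U => B.F (Literature.MathematicalPhysics.QuantumLattice.configShift (-x) (Literature.MathematicalPhysics.QuantumLattice.torusLift (2 * S + 1) U))) (Literature.MathematicalPhysics.QuantumFieldTheory.wilsonMeasure (d := 4) (L := 2 * S + 1) r.ρ β)| ≤ c * ∑ j ∈ (Finset.range (S + 1)).filter (fun j => Literature.Probability.LatticeModels.Site.supNorm x ≤ j + w ∧ j ≤ Literature.Probability.LatticeModels.Site.supNorm x + w), ∑ i : Fin k, |ProbabilityTheory.covariance (fun U => (P i).F (Literature.MathematicalPhysics.QuantumLattice.torusLift (2 * S + 1) U)) (fun U => (Q i).F (Literature.MathematicalPhysics.QuantumLattice.configShift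 (-(Pi.single 0 (j : ℤ))) (Literature.MathematicalPhysics.QuantumLattice.torusLift (2 * S + 1) U))) (Literature.MathematicalPhysics.QuantumFieldTheory.wilsonMeasure (d := 4) (L := 2 * S + 1) r.ρ β)| :=
  stub_mirrorDominationAxis0

end Summit.QuantumFields.YangMills.Theorems.FiniteSusceptibilityWeakCoupling

end
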